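import Summits.AnomalousDissipation.AnomalousDissipation.Theorems.StirringSphereEnsembleRealizationStubAugWeakFormTools

/-!
# Crux `EnsembleRealization` (stmt-AnomalousDissipation-0215) — line `augmented-lift`,
# stub `stub_augWeakForm` (M2b): modewise identities ⇒ the weak formulation (PROVED)

Supports stmt-AnomalousDissipation-0215 (registered stub `stub_augWeakForm` of line `augmented-lift`;
the reshaped skeleton composes `stub_augCurrent` + `stub_augLimit` + `stub_augWeakForm` + `stub_augEnergy`
into `stub_augmentedLaw`). Nothing here closes an item.

Main result `stub_augWeakForm`: a space–time measurable family of `L²` fields on `T³` whose Fourier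
coefficients are those of a path of a trajectory space `𝒦(R, L)` (`MomentParityDefs.pathSpace`), with
locally finite enstrophy, satisfying the modewise Navier–Stokes identities against every Galerkin mode,
is a forced weak solution on every `[0, T)` from `v 0` (`IsWeakNSSolutionForcedOn`) of class
`L²(0, T; H¹)` (`MemL2Sobolev 0 T 1`). Ingredients: the Galerkin equations in weak form against
truncated tests (`galerkin_weak_identity_of_modewise`, tools file) and the passage `M → ∞`
(`weak_form_of_modewise`: lattice tail `Torus.exists_norm_sub_fourierTruncate_le_spaceTime`, uniform
bound `∫ ‖v t‖² ≤ R²`; Robinson–Rodrigo–Sadowski 2016, Thm. 4.4 Step 4); weak divergence-freeness of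
the slices from the transversality clause of `𝒦` (`sum_mul_pathExt_eq_zero`,
`isWeaklyDivFree_of_sum_mul_mFourierCoeff_eq_zero`); the energy class from the `L∞L²` bound and the
enstrophy bound (pattern of `IsHopfGalerkinFamily.memL2Sobolev_limit`).
-/

noncomputable section

set_option linter.dupNamespace false

open MeasureTheory TopologicalSpace Set Function Filter Topology InnerProductSpace UnitAddTorus
open scoped RealInnerProductSpace ENNReal NNReal

namespace Summit.AnomalousDissipation.AnomalousDissipation.Theorems.EnsembleRealization

open Literature.Analysis.FunctionSpaces Literature.Analysis.FunctionSpaces.Torus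
open Literature.Analysis.FluidPDE Literature.Analysis.FluidPDE.Torus

open scoped BigOperators InnerProductSpace
open Summit.AnomalousDissipation.AnomalousDissipation.Theorems.MomentParity

variable {ν : ℝ} {f : UnitAddTorus (Fin 3) → EuclideanSpace ℝ (Fin 3)}
  {v : ℝ → UnitAddTorus (Fin 3) → EuclideanSpace ℝ (Fin 3)}

/-! ### The weak formulation: `M → ∞` -/

/-- **Modewise identities ⇒ the space–time weak formulation** (the fourth clause of
`IsWeakNSSolutionForcedOn`, for ONE field — no limit in `n`; Robinson–Rodrigo–Sadowski 2016,
Thm. 4.4 Step 4): for every divergence-free space–time test field `ψ` on `[0, T)`,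
`∫₀ᵀ ∫ (⟪v, ∂ₜψ⟫ + ⟪v, (v·∇)ψ⟫ + ν⟪v, Δψ⟫ + ⟪f, ψ⟫) + ∫ ⟪v 0, ψ(0)⟫ = 0`. The left-hand side `E`
satisfies `E = E - E_M` with `E_M = 0` the Galerkin identity against `P_M ψ`
(`galerkin_weak_identity_of_modewise`), and `|E - E_M| ≤ τ_M · const` with the lattice tail
`τ_M → 0` (`exists_norm_sub_fourierTruncate_le_spaceTime`, the uniform bound `∫ ‖v t‖² ≤ Y`). -/
theorem weak_form_of_modewise (hf : IsSmooth f)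
    (hvm : AEStronglyMeasurable (stLift v) (volume.restrict (Ioi 0 ×ˢ univ)))
    (hv : ∀ t, 0 ≤ t → MemLp (v t) 2 volume) {Y : ℝ} (hY : ∀ t, 0 ≤ t → ∫ x, ‖v t x‖ ^ 2 ≤ Y)
    (hmode : ∀ (M : ℕ) (a : UnitAddTorus (Fin 3) → EuclideanSpace ℝ (Fin 3)), IsGalerkinMode M a →
      ∀ s t : ℝ, 0 ≤ s → s ≤ t →
        (∫ x, ⟪v t x, a x⟫_ℝ) - ∫ x, ⟪v s x, a x⟫_ℝ =
          ∫ τ in s..t, ∫ x, (⟪v τ x, convect (v τ) a x⟫_ℝ + ν * ⟪v τ x, laplacian a x⟫_ℝ + ⟪f x, a x⟫_ℝ))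
    {T : ℝ} (hT : 0 < T) {ψ : ℝ → UnitAddTorus (Fin 3) → EuclideanSpace ℝ (Fin 3)} (hψ : IsSpaceTimeTest T ψ)
    (hdiv : IsDivFreeTest ψ) :
    (∫ t in Ioo 0 T, ∫ x, (⟪v t x, Torus.timeDeriv ψ t x⟫_ℝ + ⟪v t x, convect (v t) (ψ t) x⟫_ℝ +
        ν * ⟪v t x, laplacian (ψ t) x⟫_ℝ + ⟪f x, ψ t x⟫_ℝ)) + ∫ x, ⟪v 0 x, ψ 0 x⟫_ℝ = 0 := by
  have hf2 : MemLp f 2 volume := hf.memLp 2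
  have hfm : AEStronglyMeasurable (stLift fun _ : ℝ => f) (volume.restrict (Ioi (0 : ℝ) ×ˢ univ)) :=
    aestronglyMeasurable_stLift_const hf _
  have hf0 : 0 ≤ ∫ x, ‖f x‖ ^ 2 := integral_nonneg fun x => sq_nonneg _
  have hY0 : 0 ≤ Y := (integral_nonneg fun x => sq_nonneg _).trans (hY 0 le_rfl)
  have hv0i : Integrable (v 0) volume := (hv 0 le_rfl).integrable one_le_two
  -- uniform truncation errors of the test data and the lattice tail
  obtain ⟨K₀, hK₀0, hK₀⟩ := exists_norm_sub_fourierTruncate_le_spaceTime (hψ.isSmoothSpaceTimeOn univ) T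
  obtain ⟨K₁, hK₁0, hK₁⟩ := exists_norm_sub_fourierTruncate_le_spaceTime (hψ.timeDeriv.isSmoothSpaceTimeOn univ) T
  obtain ⟨K₂, hK₂0, hK₂⟩ := exists_norm_sub_fourierTruncate_le_spaceTime hψ.isSmoothSpaceTimeOn_laplacian T
  choose K₃ hK₃0 hK₃ using fun i => exists_norm_sub_fourierTruncate_le_spaceTime (hψ.isSmoothSpaceTimeOn_partialDeriv i) T
  obtain ⟨τ, hτdef⟩ : ∃ τ : ℕ → ℝ, τ = fun M => ∑' k : {k // k ∉ freqBall (d := Fin 3) M},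
    ((1 + freqNormSq (k : Fin 3 → ℤ)) ^ Fintype.card (Fin 3))⁻¹ := ⟨_, rfl⟩
  have hτ0 : ∀ M, 0 ≤ τ M := fun M => by
    rw [hτdef]
    exact tsum_nonneg fun k => inv_nonneg.2 (pow_nonneg (by linarith [freqNormSq_nonneg (k : Fin 3 → ℤ)]) _)
  have hτlim : Tendsto τ atTop (𝓝 0) := by rw [hτdef]; exact tendsto_tsum_compl_freqBall_inv_pow
  obtain ⟨K3, hK3def⟩ : ∃ K3 : ℝ, K3 = ∑ i, K₃ i := ⟨_, rfl⟩
  have hK30 : 0 ≤ K3 := by rw [hK3def]; exact Finset.sum_nonneg fun i _ => hK₃0 i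
  obtain ⟨a, hadef⟩ : ∃ a : ℝ, a = (K₁ + |ν| * K₂) / 2 + K3 := ⟨_, rfl⟩
  obtain ⟨c, hcdef⟩ : ∃ c : ℝ, c = (K₁ + |ν| * K₂) / 2 + K₀ / 2 * (∫ x, ‖f x‖ ^ 2) + K₀ / 2 := ⟨_, rfl⟩
  have ha0 : 0 ≤ a := by rw [hadef]; positivity
  have hc0 : 0 ≤ c := by rw [hcdef]; positivity
  obtain ⟨Mc, hMcdef⟩ : ∃ Mc : ℝ, Mc = T * (a * Y + c) + K₀ * (2⁻¹ + 2⁻¹ * Y) := ⟨_, rfl⟩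
  -- the untruncated slice functional is integrable on `(0, T)`
  obtain ⟨Kp, KL, Kq, Cψ, hCψ0, hKp, hKL, hKq, hCψ⟩ := hψ.exists_bounds
  have hKp0 : 0 ≤ Kp := (norm_nonneg _).trans (hKp 0 ⟨le_rfl, hT.le⟩ 0)
  have hKL0 : 0 ≤ KL := (norm_nonneg _).trans (hKL 0 ⟨le_rfl, hT.le⟩ 0)
  have hKq0 : 0 ≤ Kq := (norm_nonneg _).trans (hKq 0 ⟨le_rfl, hT.le⟩ 0)
  have iΦ : IntegrableOn (fun t => ∫ x, (⟪v t x, Torus.timeDeriv ψ t x⟫_ℝ + ⟪v t x, convect (v t) (ψ t) x⟫_ℝ +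
      ν * ⟪v t x, laplacian (ψ t) x⟫_ℝ + ⟪f x, ψ t x⟫_ℝ)) (Ioo 0 T) volume := by
    refine Integrable.mono' (integrableOn_const (C := (Kp / 2 + |ν| * KL / 2 + Cψ) * Y + Kq / 2 * (∫ x, ‖f x‖ ^ 2) +
      (Kp / 2 + |ν| * KL / 2 + Kq / 2)) measure_Ioo_lt_top.ne) (aestronglyMeasurable_sliceFunctional_limit hψ hfm hvm ν) ?_
    filter_upwards [ae_restrict_mem measurableSet_Ioo] with t ht
    have ht' : t ∈ Icc 0 T := ⟨ht.1.le, ht.2.le⟩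
    refine (norm_sliceFunctional_le (hv t ht.1.le) hf2 (hψ.isSmooth_slice t) hKp0 hKL0 hKq0 (hCψ t ht') (hKp t ht')
      (hKL t ht') (hKq t ht') ν).trans ?_
    gcongr
    exact hY t ht.1.le
  -- the bound `|E| ≤ τ M * Mc` for every truncation order `M`
  have hbound : ∀ M : ℕ, |(∫ t in Ioo 0 T, ∫ x, (⟪v t x, Torus.timeDeriv ψ t x⟫_ℝ + ⟪v t x, convect (v t) (ψ t) x⟫_ℝ +
      ν * ⟪v t x, laplacian (ψ t) x⟫_ℝ + ⟪f x, ψ t x⟫_ℝ)) + ∫ x, ⟪v 0 x, ψ 0 x⟫_ℝ| ≤ τ M * Mc := by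
    intro M
    -- the Galerkin identity against `P_M ψ`, set-integral form
    obtain ⟨iΦP, hGW⟩ := galerkin_weak_identity_of_modewise hf hvm hv hY (hmode M) hT hψ hdiv
    rw [intervalIntegral.integral_of_le hT.le, integral_Ioc_eq_integral_Ioo] at hGW
    have iΦP' := ((intervalIntegrable_iff_integrableOn_Ioo_of_le hT.le).1 iΦP)
    -- `E = ∫ (Φ - Φ^P) + ∫ ⟪v 0, ψ 0 - P ψ 0⟫`
    have i0 : Integrable (fun x => ⟪v 0 x, ψ 0 x⟫_ℝ) volume :=
      Torus.integrable_inner_of_continuous hv0i (hψ.isSmooth_slice 0).continuous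
    have i0P : Integrable (fun x => ⟪v 0 x, fourierTruncate M (ψ 0) x⟫_ℝ) volume :=
      Torus.integrable_inner_of_continuous hv0i (continuous_fourierTruncate M (ψ 0))
    have hsplit : (∫ t in Ioo 0 T, ∫ x, (⟪v t x, Torus.timeDeriv ψ t x⟫_ℝ + ⟪v t x, convect (v t) (ψ t) x⟫_ℝ +
        ν * ⟪v t x, laplacian (ψ t) x⟫_ℝ + ⟪f x, ψ t x⟫_ℝ)) + ∫ x, ⟪v 0 x, ψ 0 x⟫_ℝ =
        (∫ t in Ioo 0 T, ((∫ x, (⟪v t x, Torus.timeDeriv ψ t x⟫_ℝ + ⟪v t x, convect (v t) (ψ t) x⟫_ℝ +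
          ν * ⟪v t x, laplacian (ψ t) x⟫_ℝ + ⟪f x, ψ t x⟫_ℝ)) -
          ∫ x, (⟪v t x, fourierTruncate M (Torus.timeDeriv ψ t) x⟫_ℝ +
            ⟪v t x, convect (v t) (fourierTruncate M (ψ t)) x⟫_ℝ +
            ν * ⟪v t x, laplacian (fourierTruncate M (ψ t)) x⟫_ℝ + ⟪f x, fourierTruncate M (ψ t) x⟫_ℝ))) +
        ∫ x, ⟪v 0 x, ψ 0 x - fourierTruncate M (ψ 0) x⟫_ℝ := by
      rw [integral_sub iΦ iΦP']
      simp_rw [inner_sub_right]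
      rw [integral_sub i0 i0P]
      linarith
    rw [hsplit]
    -- time integration of the slice bound
    have hslice : ∀ t ∈ Ioo 0 T, ‖(∫ x, (⟪v t x, Torus.timeDeriv ψ t x⟫_ℝ + ⟪v t x, convect (v t) (ψ t) x⟫_ℝ +
        ν * ⟪v t x, laplacian (ψ t) x⟫_ℝ + ⟪f x, ψ t x⟫_ℝ)) -
        ∫ x, (⟪v t x, fourierTruncate M (Torus.timeDeriv ψ t) x⟫_ℝ + ⟪v t x, convect (v t) (fourierTruncate M (ψ t)) x⟫_ℝ +
          ν * ⟪v t x, laplacian (fourierTruncate M (ψ t)) x⟫_ℝ + ⟪f x, fourierTruncate M (ψ t) x⟫_ℝ)‖ ≤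
        τ M * (a * Y + c) := by
      intro t ht
      have ht' : t ∈ Icc 0 T := ⟨ht.1.le, ht.2.le⟩
      have hτn := hτ0 M
      have h := norm_sliceFunctional_trunc_sub_le hψ M t (hv t ht.1.le) hf2
        (e₀ := K₀ * τ M) (e₁ := K₁ * τ M) (e₂ := K₂ * τ M) (e₃ := K3 * τ M)
        (mul_nonneg hK₀0 hτn) (mul_nonneg hK₁0 hτn) (mul_nonneg hK₂0 hτn)
        (fun x => by rw [hτdef]; exact hK₀ _ t ht' x) (fun x => by rw [hτdef]; exact hK₁ _ t ht' x)
        (fun x => by rw [hτdef]; exact hK₂ _ t ht' x)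
        (fun x => by
          rw [hK3def, Finset.sum_mul]
          exact Finset.sum_le_sum fun i _ => by rw [hτdef]; exact hK₃ i _ t ht' x) ν
      refine h.trans ?_
      have h1 : (K₁ * τ M / 2 + |ν| * (K₂ * τ M) / 2 + K3 * τ M) * (∫ x, ‖v t x‖ ^ 2) ≤
          (K₁ * τ M / 2 + |ν| * (K₂ * τ M) / 2 + K3 * τ M) * Y :=
        mul_le_mul_of_nonneg_left (hY t ht.1.le) (by positivity)
      rw [hadef, hcdef]
      nlinarith [h1, hf0, hτn, hK₀0]
    have h1 : ‖∫ t in Ioo 0 T, ((∫ x, (⟪v t x, Torus.timeDeriv ψ t x⟫_ℝ + ⟪v t x, convect (v t) (ψ t) x⟫_ℝ +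
        ν * ⟪v t x, laplacian (ψ t) x⟫_ℝ + ⟪f x, ψ t x⟫_ℝ)) -
        ∫ x, (⟪v t x, fourierTruncate M (Torus.timeDeriv ψ t) x⟫_ℝ + ⟪v t x, convect (v t) (fourierTruncate M (ψ t)) x⟫_ℝ +
          ν * ⟪v t x, laplacian (fourierTruncate M (ψ t)) x⟫_ℝ + ⟪f x, fourierTruncate M (ψ t) x⟫_ℝ))‖ ≤
        τ M * (T * (a * Y + c)) := by
      refine (norm_integral_le_of_norm_le (integrableOn_const (C := τ M * (a * Y + c)) measure_Ioo_lt_top.ne)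
        ((ae_restrict_mem measurableSet_Ioo).mono hslice)).trans (le_of_eq ?_)
      rw [setIntegral_const, Real.volume_real_Ioo_of_le hT.le, sub_zero, smul_eq_mul]
      ring
    have h2 : ‖∫ x, ⟪v 0 x, ψ 0 x - fourierTruncate M (ψ 0) x⟫_ℝ‖ ≤ τ M * (K₀ * (2⁻¹ + 2⁻¹ * Y)) := by
      have ig : Integrable (fun x => ‖v 0 x‖ * (K₀ * τ M)) volume := hv0i.norm.mul_const _
      have h21 : ‖∫ x, ⟪v 0 x, ψ 0 x - fourierTruncate M (ψ 0) x⟫_ℝ‖ ≤ (∫ x, ‖v 0 x‖) * (K₀ * τ M) := by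
        refine (norm_integral_le_of_norm_le ig (ae_of_all _ fun x => ?_)).trans (le_of_eq ?_)
        · rw [Real.norm_eq_abs]
          refine (abs_real_inner_le_norm _ _).trans (mul_le_mul_of_nonneg_left ?_ (norm_nonneg _))
          rw [hτdef]; exact hK₀ _ 0 ⟨le_rfl, hT.le⟩ x
        · rw [integral_mul_const]
      -- `∫ ‖v 0‖ ≤ ½ + ½ ∫ ‖v 0‖² ≤ ½ + ½ Y`
      have h22 : ∫ x, ‖v 0 x‖ ≤ 2⁻¹ + 2⁻¹ * Y := by
        have i2 : Integrable (fun x => ‖v 0 x‖ ^ 2) volume := (hv 0 le_rfl).integrable_norm_pow two_ne_zero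
        have h3 : ∫ x, ‖v 0 x‖ ≤ ∫ x, ((2⁻¹ : ℝ) + 2⁻¹ * ‖v 0 x‖ ^ 2) := by
          refine integral_mono hv0i.norm ((integrable_const _).add (i2.const_mul _)) fun x => ?_
          dsimp only
          nlinarith [sq_nonneg (‖v 0 x‖ - 1)]
        rw [integral_add (integrable_const _) (i2.const_mul _), integral_const_mul, integral_const] at h3
        simp only [Measure.real, measure_univ, ENNReal.toReal_one, one_smul] at h3
        nlinarith [h3, hY 0 le_rfl]
      refine h21.trans ?_
      have hKτ : 0 ≤ K₀ * τ M := mul_nonneg hK₀0 (hτ0 _)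
      nlinarith [mul_le_mul_of_nonneg_right h22 hKτ]
    rw [← Real.norm_eq_abs]
    refine (norm_add_le _ _).trans ?_
    rw [hMcdef]
    nlinarith [h1, h2, hτ0 M]
  -- conclusion: `τ M → 0`
  have hlim : Tendsto (fun M => τ M * Mc) atTop (𝓝 0) := by simpa using hτlim.mul_const Mc
  exact abs_nonpos_iff.1 (ge_of_tendsto' hlim hbound)

/-! ### The field of a path: the weak formulation and the energy class -/

/-- **Sub-stub M2b (weak form from modewise identities; M/L, deterministic).** A space–time
measurable family of `L²` fields `v t` on `T³` whose Fourier coefficients are those of a path of a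
trajectory space `𝒦(R, L)` (hence `‖v t‖ ≤ R`, weakly continuous, weakly divergence free), with
locally finite enstrophy, satisfying the modewise Navier–Stokes identities
`(v t, a) − (v s, a) = ∫ₛᵗ (⟪v, (v·∇)a⟫ + ν⟪v, Δa⟫ + ⟪f, a⟫)` against every Galerkin mode `a`
(`IsGalerkinMode`, all orders), is a forced weak solution on every `[0, T)` from `v 0`
(`IsWeakNSSolutionForcedOn`) of class `L²(0, T; H¹)` (`MemL2Sobolev 0 T 1`). Proof pattern (the
tree's `IsHopfGalerkinFamily.galerkin_weak_identity` / `tendsto_weakFunctional`, here for ONE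
field, no limit in `n`): for a divergence-free space–time test `ψ`, expand the truncation
`P_M ψ(t) = ∑ᵢ λᵢ(t) aᵢ` along transversal frames (`fourierTruncate_eq_sum_frame`,
`hasDerivAt_mFourierCoeff_slice`), integrate the one-mode identities by parts in time
(`intervalIntegral_mode_ibp` pattern: `t ↦ (v t, aᵢ)` is absolutely continuous by hypothesis),
sum, and let `M → ∞` with `Torus.exists_norm_sub_fourierTruncate_le_spaceTime` and the uniform
bound `∫ ‖v t‖² ≤ R²`; weak divergence-freeness from the transversality clause of `𝒦`
(`sum_mul_pathExt_eq_zero`); `MemL2Sobolev` from `L∞L²`, the enstrophy bound and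
`eGradNormSq_eq_tsum` (pattern of `IsHopfGalerkinFamily.memL2Sobolev_limit`).
[RobinsonRodrigoSadowski2016 Thm 4.4 Step 4, Def. 3.3; arXiv:1402.4788 §7] -/
theorem stub_augWeakForm (hf : IsSmooth f) {R : ℝ} {L : (Fin 3 → ℤ) → ℝ} {ω : Path (Fin 3)}
    (hω : ω ∈ pathSpace R L) {v : ℝ → UnitAddTorus (Fin 3) → EuclideanSpace ℝ (Fin 3)}
    (hvm : AEStronglyMeasurable (stLift v) (volume.restrict (Ioi 0 ×ˢ univ)))
    (hcoef : ∀ t, 0 ≤ t → MemLp (v t) 2 volume ∧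
      ∀ k, mFourierCoeff (EuclideanSpace.complexify ∘ v t) k = pathExt ω t k)
    (hmode : ∀ (M : ℕ) (a : UnitAddTorus (Fin 3) → EuclideanSpace ℝ (Fin 3)), IsGalerkinMode M a →
      ∀ s t : ℝ, 0 ≤ s → s ≤ t →
        (∫ x, ⟪v t x, a x⟫_ℝ) - ∫ x, ⟪v s x, a x⟫_ℝ =
          ∫ τ in s..t, ∫ x, (⟪v τ x, convect (v τ) a x⟫_ℝ + ν * ⟪v τ x, laplacian a x⟫_ℝ +
            ⟪f x, a x⟫_ℝ))
    (hens : ∀ T, 0 < T → ∫⁻ t in Ioo 0 T, eGradNormSq (v t) < ∞) :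
    ∀ T, 0 < T → IsWeakNSSolutionForcedOn T ν (fun _ => f) (v 0) v ∧
      MemL2Sobolev 0 T 1 (fun t => EuclideanSpace.complexify ∘ v t) := by
  intro T hT
  have hv : ∀ t, 0 ≤ t → MemLp (v t) 2 volume := fun t ht => (hcoef t ht).1
  have hY : ∀ t, 0 ≤ t → ∫ x, ‖v t x‖ ^ 2 ≤ R ^ 2 := fun t ht => by
    rw [integral_norm_sq_eq_pathEnergyTot (hcoef t ht).1 (hcoef t ht).2]; exact pathEnergyTot_le hω t
  have hL2 : ∀ t, 0 ≤ t → ∫⁻ x, ‖v t x‖ₑ ^ 2 ≤ ENNReal.ofReal (R ^ 2) := fun t ht => by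
    rw [Torus.lintegral_enorm_sq_eq_ofReal (hv t ht)]; exact ENNReal.ofReal_le_ofReal (hY t ht)
  have hGfin := hens T hT
  refine ⟨⟨hvm.mono_measure (Measure.restrict_mono (prod_mono Ioo_subset_Ioi_self subset_rfl) le_rfl), ?_, ?_,
    fun ψ hψ hdiv => weak_form_of_modewise hf hvm hv hY hmode hT hψ hdiv⟩, ?_, ?_⟩
  · -- `L²ₜₓ`
    calc ∫⁻ t in Ioo 0 T, ∫⁻ x, ‖v t x‖ₑ ^ 2 ≤ ∫⁻ _ in Ioo 0 T, ENNReal.ofReal (R ^ 2) :=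
          setLIntegral_mono' measurableSet_Ioo fun t ht => hL2 t ht.1.le
      _ < ⊤ := by
          rw [setLIntegral_const]
          exact ENNReal.mul_lt_top ENNReal.ofReal_lt_top measure_Ioo_lt_top
  · -- weakly divergence free slices (transversality of the path)
    filter_upwards [ae_restrict_mem measurableSet_Ioo] with t ht
    refine isWeaklyDivFree_of_sum_mul_mFourierCoeff_eq_zero (hv t ht.1.le) fun k => ?_
    rw [(hcoef t ht.1.le).2 k]
    exact sum_mul_pathExt_eq_zero hω t k
  · -- a.e. slice is in `H¹`
    have hGm : AEMeasurable (fun t => eGradNormSq (v t)) (volume.restrict (Ioo 0 T)) :=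
      Torus.aemeasurable_eGradNormSq_of_coeff fun k => aestronglyMeasurable_mFourierCoeff_stSlice hvm T k
    filter_upwards [ae_lt_top' hGm hGfin.ne, ae_restrict_mem measurableSet_Ioo] with t hGt ht
    refine ⟨integrable_complexify_comp ((hv t ht.1.le).integrable one_le_two), ?_⟩
    have h := Torus.eSobolevNorm_one_complexify_sq_le (hv t ht.1.le)
    have hfin : (∫⁻ x, ‖v t x‖ₑ ^ 2) + eGradNormSq (v t) < ⊤ :=
      ENNReal.add_lt_top.2 ⟨lt_of_le_of_lt (hL2 t ht.1.le) ENNReal.ofReal_lt_top, hGt⟩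
    have h2 : eSobolevNorm 1 (EuclideanSpace.complexify ∘ v t) ^ 2 < ⊤ := lt_of_le_of_lt h hfin
    by_contra htop
    rw [not_lt, top_le_iff] at htop
    rw [htop, ENNReal.top_pow two_ne_zero] at h2
    exact lt_irrefl _ h2
  · -- `∫₀ᵀ ‖v‖²_{H¹} < ∞`
    rw [eL2SobolevNorm]
    refine ENNReal.rpow_lt_top_of_nonneg (by norm_num) (lt_top_iff_ne_top.1 ?_)
    calc ∫⁻ t in Ioo 0 T, eSobolevNorm 1 (EuclideanSpace.complexify ∘ v t) ^ 2
        ≤ ∫⁻ t in Ioo 0 T, ((∫⁻ x, ‖v t x‖ₑ ^ 2) + eGradNormSq (v t)) :=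
          setLIntegral_mono' measurableSet_Ioo fun t ht => Torus.eSobolevNorm_one_complexify_sq_le (hv t ht.1.le)
      _ ≤ ∫⁻ t in Ioo 0 T, (ENNReal.ofReal (R ^ 2) + eGradNormSq (v t)) :=
          setLIntegral_mono' measurableSet_Ioo fun t ht => add_le_add (hL2 t ht.1.le) le_rfl
      _ = (∫⁻ _ in Ioo 0 T, ENNReal.ofReal (R ^ 2)) + ∫⁻ t in Ioo 0 T, eGradNormSq (v t) :=
          lintegral_add_left' aemeasurable_const _
      _ < ⊤ := by
          rw [setLIntegral_const]
          exact ENNReal.add_lt_top.2 ⟨ENNReal.mul_lt_top ENNReal.ofReal_lt_top measure_Ioo_lt_top, hGfin⟩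

end Summit.AnomalousDissipation.AnomalousDissipation.Theorems.EnsembleRealization
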